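import Summits.BirchSwinnertonDyer.BirchSwinnertonDyer.Theorems.ManinLocalTwoThreeNotTrivialEisensteinOdd
import HarnessLib

/-!
# E-es-40 at a prime `t` REDUCED to a Chebotarev-free statement: «some `g ∈ Γ_ℚ` fixes `ζ_{t^m}` and moves a point of `W[2]`»

Route `ManinLocalTwoThree` (cell bsd-f2-manin), crux C2 `ManinOddAtFour` (stmt-BirchSwinnertonDyer-22967), line `kato_shift_two` v8,
stub 5 `stub_notTrivialEisensteinTwo : NotTrivialEisensteinOfIrreducibleTwo` (E-es-40).  The lead's Theorem A
(`ManinLocalTwoThreeNotTrivialEisensteinOdd`, p612387) contains the whole Chebotarev argument and asks only for an element of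
`Stab(ζ_{t^{M+1}})` acting on `W[2]` without non-zero fixed point; Theorem B supplied it for `t ≡ 2 (mod 3)`.  Here:

* §1 `exists_mem_fixedPointFree_of_smul_ne` — on a four-element elementary abelian `2`-group with a fixed-point-free `τ`, any
  `τ`-conjugation-stable subgroup containing an element that MOVES some point contains a FIXED-POINT-FREE element (a «transposition»
  `s` gives the «`3`-cycle» `s · τsτ⁻¹`; explicit computation on `{0, v, τv, v + τv}`);
* §2 **Theorem C `exists_prime_modEq_one_reductionPointCount_odd_of_exists_smul_ne`** — E-es-40's conclusion at ANY prime `t`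
  for `W` globally minimal with `W[2]` irreducible, from the NON-CONTAINMENT hypothesis «for every primitive `t^{M+1}`-th root of
  unity `ζ` some `g ∈ Γ_ℚ` fixes `ζ` and moves a point of `W[2]`» (= `ℚ(W[2]) ⊄ ℚ(ζ_{t^{M+1}})`); and the general-model / `a_r`
  form `exists_prime_modEq_one_lFunction_odd_of_exists_smul_ne`.

So stub 5 is now reduced to a CHEBOTAREV-FREE, HECKE-FREE statement of algebraic number theory: for `W[2]` irreducible and `t² ∤ N`
(`t` odd), `ℚ(W[2]) ⊄ ℚ(ζ_{t^∞})` — by ramification at `t` (good `t`: Néron–Ogg–Shafarevich, tree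
`ramificationIdx_divisionField_eq_one_of_hasGoodReductionAt`; `t ∥ N`: multiplicative, `e` a power of `2`, tree
`exists_ramificationIdx_divisionField_eq_pow_of_hasMultiplicativeReductionAt`; versus `e = 3` for a cubic subfield of the totally
ramified `ℚ(ζ_{t^m})`, Mathlib `IsCyclotomicExtension.Rat.ramificationIdx_eq_of_prime_pow`).  No new definitions; axioms standard;
nothing about BSD or Manin's conjecture is proved here.  References: J.-P. Serre, Invent. Math. 15 (1972) §4; J. Tate, GCFT §2.4;
HOME/MEMO-es.md §25.1.
-/

set_option autoImplicit false
set_option linter.dupNamespace false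

noncomputable section

open scoped Classical

open NumberField IsDedekindDomain Field WeierstrassCurve
  Literature.NumberTheory.EllipticCurves Literature.NumberTheory.GaloisRepresentations
  Summit.BirchSwinnertonDyer.Rank1Residual.ManinAdditive

namespace Summit.BirchSwinnertonDyer.BirchSwinnertonDyer.Theorems.ManinLocalTwoThree

/-! ### §1  Group theory on a four-element `2`-group: a non-trivial element and a `3`-cycle give a `3`-cycle in any `τ`-stable subgroup -/

section Transposition

variable {G A : Type*} [Group G] [AddCommGroup A] [DistribMulAction G A]

/-- The four elements `0, v, w, v + w` exhaust an elementary abelian `2`-group of order `4` (`v, w ≠ 0`, `v ≠ w`). [folklore] -/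
theorem eq_zero_or_eq_or_eq_or_eq_add (h2 : ∀ a : A, a + a = 0) (hcard : Nat.card A = 4) {v w : A} (hv : v ≠ 0) (hw : w ≠ 0)
    (hwv : w ≠ v) (a : A) : a = 0 ∨ a = v ∨ a = w ∨ a = v + w := by
  haveI : Finite A := Nat.finite_of_card_ne_zero (by rw [hcard]; norm_num)
  letI : Fintype A := Fintype.ofFinite A
  have hneg : ∀ x : A, -x = x := fun x ↦ (neg_eq_of_add_eq_zero_left (h2 x))
  have hs0 : v + w ≠ 0 := fun h0 ↦ hwv (by
    have h1 : w = -v := eq_neg_of_add_eq_zero_right h0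
    rw [hneg] at h1; exact h1)
  have hsv : v + w ≠ v := fun h ↦ hw (by simpa using h)
  have hsw : v + w ≠ w := fun h ↦ hv (by simpa using h)
  let s : Finset A := {0, v, w, v + w}
  have hs : s.card = 4 := by
    simp only [s]
    rw [Finset.card_insert_of_notMem, Finset.card_insert_of_notMem, Finset.card_insert_of_notMem,
      Finset.card_singleton]
    · simp only [Finset.mem_singleton]; exact fun h ↦ hsw h.symm
    · simp only [Finset.mem_insert, Finset.mem_singleton, not_or]; exact ⟨hwv.symm, fun h ↦ hsv h.symm⟩
    · simp only [Finset.mem_insert, Finset.mem_singleton, not_or]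
      exact ⟨fun h ↦ hv h.symm, fun h ↦ hw h.symm, fun h ↦ hs0 h.symm⟩
  have hsu : s = Finset.univ := Finset.eq_univ_of_card s (by rw [hs, ← Nat.card_eq_fintype_card, hcard])
  have hmem : a ∈ s := by rw [hsu]; exact Finset.mem_univ _
  simpa only [s, Finset.mem_insert, Finset.mem_singleton] using hmem

/-- **From a non-trivial element to a fixed-point-free one.**  Let `A` be an elementary abelian `2`-group with four elements,
`τ ∈ G` fixed-point-free on `A`, `H ≤ G` a subgroup stable under conjugation by `τ`, and `g ∈ H` acting non-trivially on `A`.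
Then `H` contains an element acting without non-zero fixed point: either `g` itself, or — if `g` fixes some `v ≠ 0`, i.e. `g` is
the «transposition» `w ↔ v + w` (`w = τv`) — the product `g · τgτ⁻¹`, which is the «`3`-cycle» `v ↦ w ↦ v + w ↦ v`. [folklore] -/
theorem exists_mem_fixedPointFree_of_smul_ne (h2 : ∀ a : A, a + a = 0) (hcard : Nat.card A = 4) {τ : G}
    (hτ : ∀ a : A, a ≠ 0 → τ • a ≠ a) (H : Subgroup G) (hH : ∀ x ∈ H, τ * x * τ⁻¹ ∈ H) {g : G} (hg : g ∈ H)
    (hne : ∃ a : A, g • a ≠ a) : ∃ h ∈ H, ∀ a : A, a ≠ 0 → h • a ≠ a := by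
  by_cases hfix : ∀ a : A, a ≠ 0 → g • a ≠ a
  · exact ⟨g, hg, hfix⟩
  push Not at hfix
  obtain ⟨v, hv, hgv⟩ := hfix
  -- the three non-zero elements `v`, `w := τ v`, `v + w`; `τ w = v + w`, `τ (v + w) = v`
  have hw : τ • v ≠ 0 := fun h ↦ hv ((smul_eq_zero_iff_eq τ).mp h)
  have hwv : τ • v ≠ v := hτ v hv
  have hτw : τ • τ • v = v + τ • v := smul_smul_eq_add h2 hcard hτ v hv
  have hτvw : τ • (v + τ • v) = v := by
    rw [smul_add, hτw, add_comm v (τ • v), ← add_assoc, h2, zero_add]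
  have hτinv_v : τ⁻¹ • v = v + τ • v := by
    rw [inv_smul_eq_iff, hτvw]
  have hτinv_w : τ⁻¹ • (τ • v) = v := inv_smul_smul τ v
  have four := eq_zero_or_eq_or_eq_or_eq_add h2 hcard hv hw hwv
  -- `g` moves `w` (else `g = 1` on `A`), hence `g w = v + w` and `g (v + w) = w`
  have hgw_ne : g • τ • v ≠ τ • v := by
    intro hgw
    obtain ⟨a, ha⟩ := hne
    apply ha
    rcases four a with rfl | rfl | rfl | rfl
    · exact smul_zero g
    · exact hgv
    · exact hgw
    · rw [smul_add, hgv, hgw]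
  have hgw : g • τ • v = v + τ • v := by
    rcases four (g • τ • v) with h | h | h | h
    · exact (hw ((smul_eq_zero_iff_eq g).mp h)).elim
    · exact (hwv (smul_left_cancel g (h.trans hgv.symm))).elim
    · exact (hgw_ne h).elim
    · exact h
  have hgvw : g • (v + τ • v) = τ • v := by
    rw [smul_add, hgv, hgw, ← add_assoc, h2, zero_add]
  -- the conjugate `g' = τ g τ⁻¹`: `g' w = w`, `g' v = v + w`, `g' (v + w) = v`
  have hg'w : (τ * g * τ⁻¹) • τ • v = τ • v := by
    rw [mul_smul, mul_smul, hτinv_w, hgv]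
  have hg'v : (τ * g * τ⁻¹) • v = v + τ • v := by
    rw [mul_smul, mul_smul, hτinv_v, hgvw, hτw]
  have hg'vw : (τ * g * τ⁻¹) • (v + τ • v) = v := by
    rw [smul_add, hg'v, hg'w, add_assoc, h2, add_zero]
  -- the product is fixed-point-free
  refine ⟨g * (τ * g * τ⁻¹), H.mul_mem hg (hH g hg), fun a ha ↦ ?_⟩
  rcases four a with rfl | rfl | rfl | rfl
  · exact (ha rfl).elim
  · rw [mul_smul, hg'v, hgvw]; exact hwv
  · rw [mul_smul, hg'w, hgw]
    intro h; exact hv (by simpa using h)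
  · rw [mul_smul, hg'vw, hgv]
    intro h; exact hw (by simpa using h.symm)

end Transposition

/-! ### §2  Theorem C: E-es-40 at a prime `t` from the non-containment `ℚ(W[2]) ⊄ ℚ(ζ_{t^{M+1}})` -/

section Reduction

/-- **Theorem C.**  For `W` globally minimal with `W[2]` irreducible, a prime `t`, `S` finite and `M`: if for every primitive
`t^{M+1}`-th root of unity `ζ` some `g ∈ Γ_ℚ` fixes `ζ` but moves some point of `W[2]` (i.e. `ℚ(W[2]) ⊄ ℚ(ζ)`), then there is a good
prime `ℓ ∉ S`, `ℓ ≠ 2`, `ℓ ≡ 1 (mod t^{M+1})`, with `#W̃(𝔽_ℓ)` odd.  (§1 upgrades `g` to a fixed-point-free element of `Stab(ζ)`,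
which is stable under conjugation; then Theorem A.) [cite: TateGCFT1967, §2.4 (Tchebotarev density theorem)] -/
theorem exists_prime_modEq_one_reductionPointCount_odd_of_exists_smul_ne (W : WeierstrassCurve ℚ) [W.IsElliptic]
    [W.IsGloballyMinimal] (hirr : W.HasIrreducibleModPGaloisRep 2) {t : ℕ} (ht : t.Prime) (S : Finset ℕ) (M : ℕ)
    (hNC : ∀ ζ : AlgebraicClosure ℚ, IsPrimitiveRoot ζ (t ^ (M + 1)) →
      ∃ g : absoluteGaloisGroup ℚ, g • ζ = ζ ∧ ∃ P : W.geomTorsion ((2 : ℕ) : ℤ), g • P ≠ P) :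
    ∃ (r : ℕ) (_ : Fact r.Prime), r ∉ S ∧ r ≠ 2 ∧ r ≡ 1 [MOD t ^ (M + 1)] ∧ W.HasGoodReductionAtPrime r ∧
      ¬ 2 ∣ W.reductionPointCount r := by
  classical
  haveI : Fact (Nat.Prime 2) := ⟨Nat.prime_two⟩
  refine exists_prime_modEq_one_reductionPointCount_odd_of_exists_fixedPointFree W ht S M fun ζ hζ ↦ ?_
  -- a fixed-point-free `τ` from irreducibility; the structure of `W[2]`
  obtain ⟨τ, hτ⟩ : ∃ τ : absoluteGaloisGroup ℚ, ∀ P : W.geomTorsion ((2 : ℕ) : ℤ), P ≠ 0 → τ • P ≠ P := by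
    by_contra h
    push Not at h
    exact not_irreducible_of_forall_exists_smul_eq W 2 h hirr
  have h2 : ∀ P : W.geomTorsion ((2 : ℕ) : ℤ), P + P = 0 := by
    intro P
    have hP : ((2 : ℕ) : ℤ) • (P : W.geomPoints) = 0 := by
      simpa only [AddSubgroup.torsionBy, Submodule.mem_toAddSubgroup, Submodule.mem_torsionBy_iff] using P.2
    apply Subtype.ext
    show (P : W.geomPoints) + P = 0
    rw [← two_zsmul]
    exact_mod_cast hP
  have hcard : Nat.card (W.geomTorsion ((2 : ℕ) : ℤ)) = 4 :=
    card_torsionPoints_eq_sq_holds W (AlgebraicClosure ℚ) (n := 2) (by exact_mod_cast (two_ne_zero : (2 : ℕ) ≠ 0))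
  -- the stabiliser of `ζ` is stable under conjugation by `τ`
  have hq : 0 < t ^ (M + 1) := pow_pos ht.pos _
  haveI : NeZero (t ^ (M + 1)) := ⟨hq.ne'⟩
  let H : Subgroup (absoluteGaloisGroup ℚ) := MulAction.stabilizer (absoluteGaloisGroup ℚ) ζ
  have hH : ∀ x ∈ H, τ * x * τ⁻¹ ∈ H := by
    intro x hx
    rw [MulAction.mem_stabilizer_iff] at hx ⊢
    have hτζq : (τ⁻¹ • ζ) ^ t ^ (M + 1) = 1 := by rw [← smul_pow', hζ.pow_eq_one, smul_one]
    obtain ⟨b, -, hb⟩ := hζ.eq_pow_of_pow_eq_one hτζq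
    rw [mul_smul, mul_smul, ← hb, smul_pow', hx, hb, smul_inv_smul]
  obtain ⟨g, hgζ, P₀, hP₀⟩ := hNC ζ hζ
  obtain ⟨h, hhH, hh⟩ := exists_mem_fixedPointFree_of_smul_ne h2 hcard hτ H hH
    (MulAction.mem_stabilizer_iff.mpr hgζ) ⟨P₀, hP₀⟩
  exact ⟨h, MulAction.mem_stabilizer_iff.mp hhH, hh⟩

/-- **E-es-40 from the non-containment statement, in the leaf's currency** (general Weierstrass models, `a_r = W.LFunction r`):
for an elliptic `W/ℚ` with `W[2]` irreducible and a prime `t` such that for every `m` and every primitive `t^{m+1}`-th root of unity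
`ζ` some element of `Γ_ℚ` fixes `ζ` and moves a point of `W[2]` (on some, equivalently any, model), there are primes `r ∉ S`,
`r ≡ 1 (mod t^M)`, with `a_r(W)` odd.  This is how the remaining cases `t = 3`, `t ≡ 1 (mod 3)` of stub 5 reduce to the
CHEBOTAREV-FREE statement «`ℚ(W[2]) ⊄ ℚ(ζ_{t^∞})`», a consequence of `t² ∤ N` by ramification at `t`.
[cite: TateGCFT1967, §2.4 (Tchebotarev density theorem)] -/
theorem exists_prime_modEq_one_lFunction_odd_of_exists_smul_ne (W : WeierstrassCurve ℚ) [W.IsElliptic]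
    (hirr : W.HasIrreducibleModPGaloisRep 2) {t : ℕ} (ht : t.Prime) (S : Finset ℕ) (M : ℕ)
    (hNC : ∀ (C : VariableChange ℚ) (ζ : AlgebraicClosure ℚ), IsPrimitiveRoot ζ (t ^ (M + 1)) →
      ∃ g : absoluteGaloisGroup ℚ, g • ζ = ζ ∧ ∃ P : (C • W).geomTorsion ((2 : ℕ) : ℤ), g • P ≠ P) :
    ∃ r : ℕ, r.Prime ∧ r ∉ S ∧ r ≡ 1 [MOD t ^ M] ∧ (((W.LFunction r : ℤ) : ZMod 2)) ≠ (r : ZMod 2) + 1 := by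
  classical
  obtain ⟨C, hC⟩ := WeierstrassCurve.hasGlobalMinimalModel_rat_holds W
  haveI := hC
  have hirr' : (C • W).HasIrreducibleModPGaloisRep 2 :=
    (Mazur1978.hasIrreducibleModPGaloisRep_smul_iff W C 2).mpr hirr
  obtain ⟨r, hr, hrS, _, hmod, hgood, hodd⟩ :=
    exists_prime_modEq_one_reductionPointCount_odd_of_exists_smul_ne (C • W) hirr' ht S M (hNC C)
  refine ⟨r, hr.out, hrS, ?_, ?_⟩
  · rw [pow_succ'] at hmod
    exact Nat.ModEq.of_mul_left t hmod
  · rw [← WeierstrassCurve.LFunction_smul W C, WeierstrassCurve.LFunction_apply_prime_eq_frobeniusTrace (C • W) r hgood]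
    intro heq
    apply hodd
    have h2 : ((((r : ℤ) + 1 : ℤ)) : ZMod 2) = (((C • W).frobeniusTrace r : ℤ) : ZMod 2) := by
      rw [heq]; push_cast; ring
    have h3 := (ZMod.intCast_eq_intCast_iff_dvd_sub ((r : ℤ) + 1) ((C • W).frobeniusTrace r) 2).mp h2
    exact (dvd_frobeniusTrace_sub_iff (C • W) 2 r).mp (by exact_mod_cast h3)

end Reduction

end Summit.BirchSwinnertonDyer.BirchSwinnertonDyer.Theorems.ManinLocalTwoThree

end
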